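import Mathlib
import Summits.NavierStokesRegularity.FluidComputer.LinearisedLowerTailForms
import Summits.NavierStokesRegularity.FluidComputer.HighModePoincare
import HarnessLib

/-!
# The tail of the COUPLED (two-level) Lyapunov inequality (C1): admissibility of the smoothing rate `c` beyond the resolved shells (instab g13, cell `ns-blowup`, 2026-08-26)

HONEST FRAMING (human ruling D-0035): nothing here is a claim about Navier–Stokes blow-up.
WHAT THIS IS NOT: not NS evidence. Kernel form of the TAIL BLOCK of the coupled smoothing
certificate «3-L′» (`instab/INSTAB-BRIDGE.md` §11 l.111, §13 l.126 (a)/(b)(iii), l.127 (b)–(d);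
float gate P-EMERGE-X0 PART 4/4b): the (C1) analogue of `AbcKappa0TailLevels.weighted_levels_le`.

Setting (informal). The two-level smoothing sentence `LyapunovSkewCutSemigroup.norm_le_of_two_level`
turns the COUPLED operator inequality
(C1) `2·Re⟨G₁w, (A − ω′)w⟩ + c·Re⟨G₂w, w⟩ ≤ 0` for all `w` in the domain
into the `H¹_κ₀ → g_κ₀` smoothing bound with constant `S = √(M₁/(c·m₂))`. On the TAIL (fields with
no Fourier modes in the resolved ball) every structured certificate of PART 3/4/4b takes, in the
`y = (κ₀² − Δ)w` coordinates of the booking norm `g_κ₀`, `G₁ = t₁·diag(1/(κ₀² + |k|²))` and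
`G₂ = τ₂·I` (`t₁ = τ₁·w̄`), i.e. in terms of `w` itself
`Re⟨G₁y, (A^w − ω′)y⟩ = t₁·Re⟨(κ₀² − Δ)w, (A − ω′)w⟩ = t₁·(κ₀²·q₀ + q₁)`,
`Re⟨G₂y, y⟩ = τ₂·‖(κ₀² − Δ)w‖² = τ₂·(‖Δw‖² + 2κ₀²‖∇w‖² + κ₀⁴‖w‖²)`
(`AbcKappa0TailLevels.weight_sq_expand`), with the two LOWER level forms of
`LinearisedLowerTailForms`: `q₀ = ν∫⟪Δw, w⟫ − ∫⟪(v·∇)w + (w·∇)v, w⟫ − ω′‖w‖²` (L² level) and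
`q₁ = −ν‖Δw‖² + ∫⟪(v·∇)w + (w·∇)v, Δw⟫ − ω′‖∇w‖²` (H¹ level). So the tail block of (C1) reads
(C1-tail) `2t₁·(κ₀²·q₀ + q₁) + c·τ₂·(‖Δw‖² + 2κ₀²‖∇w‖² + κ₀⁴‖w‖²) ≤ 0`.
Unlike the one-level tail (where the whole dissipation may be spent on Poincaré), (C1-tail) must
RETAIN the dissipation `−ν‖Δw‖²` of the `H¹` level to absorb `c·τ₂‖Δw‖²`: the level forms are used
in the form `q₁ ≤ −ν‖Δw‖² + (β − ω′)‖∇w‖²`, `q₀ ≤ −ν‖∇w‖² + (s − ω′)‖w‖²` (the first-order parts of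
`h1_tail_form_le` / `l2_tail_form_le`, i.e. those theorems at viscosity `0`;
`β = √d·L + s + √d·L'/√Λ`), and the surplus is pushed down the levels by the high-mode Poincaré
inequalities `Λ‖∇w‖² ≤ ‖Δw‖²`, `Λ‖w‖² ≤ ‖∇w‖²` (`HighModePoincare`).

* `two_level_tail_le` — the scalar skeleton: with `a ≥ Λb`, `b ≥ Λe`, `e ≥ 0`, `κ = κ₀² ≥ 0`,
  `t₁ ≥ 0`, the two level bounds above and the three COEFFICIENT CONDITIONS
  (i) `cτ₂ ≤ 2t₁ν`, (ii) `cτ₂(Λ + 2κ) ≤ 2t₁(ν(Λ + κ) + ω′ − β)`,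
  (iii) `cτ₂(Λ + κ)² ≤ 2t₁((Λ + κ)(νΛ + ω′) − βΛ − sκ)`,
  one has `2t₁(κq₀ + q₁) + cτ₂(a + 2κb + κ²e) ≤ 0`. Condition (iii) is EXACTLY the per-mode
  («diagonal») admissibility `c ≤ c_tail` of the float reader `verify4b.py` at the first tail shell
  `|k|² = Λ`, with the level-correct constants (`s` at the `L²` level, `β` at the `H¹` level);
  (i)/(ii) are what the push-down needs and are slack at the cell's instance.
* `conditions_of_ratio` — packaging: if `cτ₂ ≤ θ·t₁` and the pure number `θ` satisfies
  (i′) `θ ≤ 2ν`, (ii′) `θ(Λ + 2κ) ≤ 2(ν(Λ + κ) + ω′ − β)`, (iii′) `θ(Λ + κ)² ≤ 2((Λ + κ)(νΛ + ω′) − βΛ − sκ)`,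
  then (i)–(iii) hold; so an instance only has to exhibit `θ` once («`c_tail = θ·t₁/τ₂`»).
* `two_level_tail_form_le` — the torus-calculus statement (C1-tail) itself, for a smooth
  divergence-free host `v` on the unit torus with strain bound `s`, gradient bound `L`, Hessian-row
  bound `L'`, and a smooth tail field `w` (`P_N w = 0`, `Λ = 4π²(N² + 1)`), composed from
  `LinearisedLowerTailForms.l2_tail_form_le` / `h1_tail_form_le` (at viscosity `0`),
  `integral_inner_laplacian_self_eq_neg_gradNormSq_of_isSmooth` and the two `HighModePoincare`
  inequalities. Together with `AbcKappa0TailLevels.weighted_levels_le` (the tail of the PLAIN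
  `g_κ₀`-level inequality `Re⟨G₂y, (A^w − ω′)y⟩ ≤ 0`) this makes BOTH tail inequalities of the 3-L′
  certificate format kernel sentences at the generic-constant level; the head block and the
  head∣tail junction (one shell pair, `LyapunovSkewCutSemigroup.sum_nonpos_of_schur_two`) are the
  interval stage's.
* `ratio_at_25_quarter`, `ratio_at_25_eleven_fiftieths` — threshold arithmetic at the cell's
  instance `ν = 1/100`, `√Λ ↔ K + 1 = 25`, `κ₀² = 100`, generic ABC constants `d = 3`,
  `L = L' = 1`, `s = √2` (so `β = √3 + √2 + √3/25`): (i′)–(iii′) hold with `θ = 974/100000` at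
  `ω′ = 1/4` and with `θ = 966/100000` at `ω′ = 11/50` (desk values of the binding (iii′):
  `0.0097459…` resp. `0.0096632…`; (ii′) `0.01038…`/`0.01031…`, (i′) `0.02`). READING (float,
  descriptive, NOT part of the theorems): at the 4b-II-A incumbent of record (`τ₁ = 0.0476`,
  `w̄ = 1 022.65`, `τ₂ = 0.376`, so `t₁/τ₂ ≈ 129.5`) this gives `c_tail ≈ 1.26` against the
  incumbent `c = 0.0049` — the room `×250` the RESULT line quoted from the diagonal reader, now as a
  consequence of level inequalities that include every advective coupling inside the tail.

Mathlib + the landed FluidComputer files; no new definitions.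
-/

noncomputable section

namespace Summit.NavierStokesRegularity.FluidComputer.TwoLevelTailAdmissibility

open Literature.Analysis.FunctionSpaces Literature.Analysis.FunctionSpaces.Torus MeasureTheory
open Summit.NavierStokesRegularity.FluidComputer.HighModePoincare
open Summit.NavierStokesRegularity.FluidComputer.LinearisedLowerTailForms
open scoped RealInnerProductSpace

/-! ## (A) The scalar skeleton -/

/-- **(C1-tail), scalar skeleton.** Let `a = ‖Δw‖²`, `b = ‖∇w‖²`, `e = ‖w‖²` satisfy the high-mode
Poincaré inequalities `Λb ≤ a`, `Λe ≤ b` (`e ≥ 0`), let the `H¹`- and `L²`-level forms obey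
`q₁ ≤ −νa + (β − ω)b` and `q₀ ≤ −νb + (s − ω)e` (dissipation retained), and let `κ ≥ 0`, `t₁ ≥ 0`.
Under the coefficient conditions (i) `cτ₂ ≤ 2t₁ν`, (ii) `cτ₂(Λ + 2κ) ≤ 2t₁(ν(Λ + κ) + ω − β)`,
(iii) `cτ₂(Λ + κ)² ≤ 2t₁((Λ + κ)(νΛ + ω) − βΛ − sκ)` the coupled tail form is nonpositive:
`2t₁(κq₀ + q₁) + cτ₂(a + 2κb + κ²e) ≤ 0`. (Proof: the `a`-coefficient `cτ₂ − 2t₁ν ≤ 0` is pushed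
down to `b` by `a ≥ Λb`, the resulting `b`-coefficient is `≤ 0` by (ii) and is pushed down to `e`
by `b ≥ Λe`, and the total `e`-coefficient is `cτ₂(Λ + κ)² − 2t₁(…) ≤ 0` by (iii).) -/
theorem two_level_tail_le (q₁ q₀ a b e Λ κ ν ω β s t₁ τ₂ c : ℝ) (he : 0 ≤ e) (hκ : 0 ≤ κ)
    (ht₁ : 0 ≤ t₁) (hab : Λ * b ≤ a) (hbe : Λ * e ≤ b)
    (h1 : q₁ ≤ -ν * a + (β - ω) * b) (h0 : q₀ ≤ -ν * b + (s - ω) * e)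
    (hi : c * τ₂ ≤ 2 * t₁ * ν)
    (hii : c * τ₂ * (Λ + 2 * κ) ≤ 2 * t₁ * (ν * (Λ + κ) + ω - β))
    (hiii : c * τ₂ * (Λ + κ) ^ 2 ≤ 2 * t₁ * ((Λ + κ) * (ν * Λ + ω) - β * Λ - s * κ)) :
    2 * t₁ * (κ * q₀ + q₁) + c * τ₂ * (a + 2 * κ * b + κ ^ 2 * e) ≤ 0 := by
  -- step 0: insert the two level bounds (monotone in the nonnegative weights `2t₁κ`, `2t₁`)
  have h0' : κ * q₀ ≤ κ * (-ν * b + (s - ω) * e) := mul_le_mul_of_nonneg_left h0 hκ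
  have S0 : 2 * t₁ * (κ * q₀ + q₁) ≤ 2 * t₁ * (κ * (-ν * b + (s - ω) * e) + (-ν * a + (β - ω) * b)) :=
    mul_le_mul_of_nonneg_left (add_le_add h0' h1) (by linarith)
  -- step 1: push the (nonpositive) `a`-coefficient down to `b`
  have S1 : a * (c * τ₂ - 2 * t₁ * ν) ≤ Λ * b * (c * τ₂ - 2 * t₁ * ν) := by
    nlinarith [mul_nonneg (sub_nonneg.mpr hab) (sub_nonneg.mpr hi)]
  -- step 2: push the (nonpositive) `b`-coefficient down to `e`
  have S2 : b * (c * τ₂ * (Λ + 2 * κ) - 2 * t₁ * (ν * (Λ + κ) + ω - β))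
      ≤ Λ * e * (c * τ₂ * (Λ + 2 * κ) - 2 * t₁ * (ν * (Λ + κ) + ω - β)) := by
    nlinarith [mul_nonneg (sub_nonneg.mpr hbe) (sub_nonneg.mpr hii)]
  -- step 3: the total `e`-coefficient is nonpositive
  have S3 : e * (c * τ₂ * (Λ + κ) ^ 2 - 2 * t₁ * ((Λ + κ) * (ν * Λ + ω) - β * Λ - s * κ)) ≤ 0 := by
    nlinarith [mul_nonneg he (sub_nonneg.mpr hiii)]
  linarith [S0, S1, S2, S3]

/-- **Packaging of the coefficient conditions by one pure number `θ`** («`c_tail = θ·t₁/τ₂`»):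
if `cτ₂ ≤ θt₁` with `t₁ ≥ 0`, `Λ + 2κ ≥ 0`, and `θ` satisfies (i′) `θ ≤ 2ν`,
(ii′) `θ(Λ + 2κ) ≤ 2(ν(Λ + κ) + ω − β)`, (iii′) `θ(Λ + κ)² ≤ 2((Λ + κ)(νΛ + ω) − βΛ − sκ)`,
then the three coefficient conditions (i)–(iii) of `two_level_tail_le` hold. -/
theorem conditions_of_ratio {Λ κ ν ω β s t₁ τ₂ c θ : ℝ} (ht₁ : 0 ≤ t₁) (hΛκ : 0 ≤ Λ + 2 * κ)
    (hc : c * τ₂ ≤ θ * t₁) (hθi : θ ≤ 2 * ν)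
    (hθii : θ * (Λ + 2 * κ) ≤ 2 * (ν * (Λ + κ) + ω - β))
    (hθiii : θ * (Λ + κ) ^ 2 ≤ 2 * ((Λ + κ) * (ν * Λ + ω) - β * Λ - s * κ)) :
    c * τ₂ ≤ 2 * t₁ * ν
    ∧ c * τ₂ * (Λ + 2 * κ) ≤ 2 * t₁ * (ν * (Λ + κ) + ω - β)
    ∧ c * τ₂ * (Λ + κ) ^ 2 ≤ 2 * t₁ * ((Λ + κ) * (ν * Λ + ω) - β * Λ - s * κ) := by
  refine ⟨?_, ?_, ?_⟩
  · have := mul_le_mul_of_nonneg_right hθi ht₁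
    linarith
  · have e1 : c * τ₂ * (Λ + 2 * κ) ≤ θ * t₁ * (Λ + 2 * κ) := mul_le_mul_of_nonneg_right hc hΛκ
    have e2 : θ * (Λ + 2 * κ) * t₁ ≤ 2 * (ν * (Λ + κ) + ω - β) * t₁ :=
      mul_le_mul_of_nonneg_right hθii ht₁
    linarith
  · have e1 : c * τ₂ * (Λ + κ) ^ 2 ≤ θ * t₁ * (Λ + κ) ^ 2 :=
      mul_le_mul_of_nonneg_right hc (sq_nonneg _)
    have e2 : θ * (Λ + κ) ^ 2 * t₁ ≤ 2 * ((Λ + κ) * (ν * Λ + ω) - β * Λ - s * κ) * t₁ :=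
      mul_le_mul_of_nonneg_right hθiii ht₁
    linarith

/-! ## (B) The torus-calculus statement -/

variable {d : Type*} [Fintype d] [DecidableEq d]

/-- **(C1-tail) for the linearised Navier–Stokes operator on the unit torus.** Let `v` be a smooth
divergence-free host with strain bound `|⟪a, Dv(x)a⟫| ≤ s‖a‖²`, gradient bound `‖∂ₖv(x)‖ ≤ L` and
Hessian-row bound `(∑ⱼ‖∂ⱼ∂ₖv(x)‖²)^{1/2} ≤ L'`, let `w` be a smooth tail field (`P_N w = 0`), put
`Λ = 4π²(N² + 1)`, `β = √d·L + s + √d·L'/√Λ`, and let `κ ≥ 0` (`= κ₀²`), `t₁ ≥ 0`, `τ₂`, `c`, `ν`,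
`ω` satisfy the coefficient conditions (i)–(iii) of `two_level_tail_le`. Then, with
`q₀ = ν∫⟪Δw, w⟫ − ∫⟪(v·∇)w + (w·∇)v, w⟫ − ω∫‖w‖²` and
`q₁ = −ν∫‖Δw‖² + ∫⟪(v·∇)w + (w·∇)v, Δw⟫ − ω‖∇w‖₂²`:
`2t₁(κq₀ + q₁) + cτ₂(∫‖Δw‖² + 2κ‖∇w‖₂² + κ²∫‖w‖²) ≤ 0` — the tail block of the coupled
Lyapunov inequality (C1) for the weights `G₁ = t₁(κ₀² − Δ)`-level, `G₂ = τ₂(κ₀² − Δ)²`-level. -/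
theorem two_level_tail_form_le {v w : UnitAddTorus d → EuclideanSpace ℝ d}
    (hv : IsSmooth v) (hdiv : IsDivFree v) (hw : IsSmooth w) {N : ℕ}
    (h0 : fourierTruncate N w = fun _ => 0) {ν ω s L L' κ t₁ τ₂ c : ℝ} (hL0 : 0 ≤ L)
    (hL'0 : 0 ≤ L') (hκ : 0 ≤ κ) (ht₁ : 0 ≤ t₁)
    (hS : ∀ (x : UnitAddTorus d) (a : EuclideanSpace ℝ d), |⟪a, Torus.fderiv v x a⟫| ≤ s * ‖a‖ ^ 2)
    (hL : ∀ (k : d) (x : UnitAddTorus d), ‖partialDeriv k v x‖ ≤ L)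
    (hL' : ∀ (k : d) (x : UnitAddTorus d),
      Real.sqrt (∑ j, ‖partialDeriv j (partialDeriv k v) x‖ ^ 2) ≤ L')
    (hi : c * τ₂ ≤ 2 * t₁ * ν)
    (hii : c * τ₂ * (4 * Real.pi ^ 2 * ((N : ℝ) ^ 2 + 1) + 2 * κ)
      ≤ 2 * t₁ * (ν * (4 * Real.pi ^ 2 * ((N : ℝ) ^ 2 + 1) + κ) + ω
          - (Real.sqrt (Fintype.card d) * L + s
              + Real.sqrt (Fintype.card d) * L' / Real.sqrt (4 * Real.pi ^ 2 * ((N : ℝ) ^ 2 + 1)))))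
    (hiii : c * τ₂ * (4 * Real.pi ^ 2 * ((N : ℝ) ^ 2 + 1) + κ) ^ 2
      ≤ 2 * t₁ * ((4 * Real.pi ^ 2 * ((N : ℝ) ^ 2 + 1) + κ)
            * (ν * (4 * Real.pi ^ 2 * ((N : ℝ) ^ 2 + 1)) + ω)
          - (Real.sqrt (Fintype.card d) * L + s
              + Real.sqrt (Fintype.card d) * L' / Real.sqrt (4 * Real.pi ^ 2 * ((N : ℝ) ^ 2 + 1)))
            * (4 * Real.pi ^ 2 * ((N : ℝ) ^ 2 + 1))
          - s * κ)) :
    2 * t₁ * (κ * (ν * (∫ x, ⟪laplacian w x, w x⟫)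
                  - (∫ x, ⟪convect v w x + convect w v x, w x⟫)
                  - ω * (∫ x, ‖w x‖ ^ 2))
              + (-(ν * ∫ x, ‖laplacian w x‖ ^ 2)
                  + (∫ x, ⟪convect v w x + convect w v x, laplacian w x⟫)
                  - ω * gradNormSq w))
      + c * τ₂ * ((∫ x, ‖laplacian w x‖ ^ 2) + 2 * κ * gradNormSq w + κ ^ 2 * (∫ x, ‖w x‖ ^ 2))
      ≤ 0 := by
  -- names
  set Λ : ℝ := 4 * Real.pi ^ 2 * ((N : ℝ) ^ 2 + 1) with hΛ
  set β : ℝ := Real.sqrt (Fintype.card d) * L + s + Real.sqrt (Fintype.card d) * L' / Real.sqrt Λ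
    with hβ
  set A : ℝ := ∫ x, ‖laplacian w x‖ ^ 2 with hA
  set G : ℝ := gradNormSq w with hG
  set Y : ℝ := ∫ x, ‖w x‖ ^ 2 with hY
  set P : ℝ := ∫ x, ⟪convect v w x + convect w v x, laplacian w x⟫ with hP
  set Pw : ℝ := ∫ x, ⟪convect v w x + convect w v x, w x⟫ with hPw
  -- the first-order parts of the two level forms = the level theorems at viscosity 0
  have hT1 := h1_tail_form_le hv hdiv hw h0 (ν := 0) (ω := ω) le_rfl hL0 hL'0 hS hL hL'
  have hT0 := l2_tail_form_le hv hdiv hw h0 (ν := 0) (ω := ω) le_rfl hS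
  have hvisc : ∫ x, ⟪laplacian w x, w x⟫ = -G :=
    integral_inner_laplacian_self_eq_neg_gradNormSq_of_isSmooth hw
  -- level bounds with the dissipation retained
  have h1 : -(ν * A) + P - ω * G ≤ -ν * A + (β - ω) * G := by
    have e : -(0 * A) + P - ω * G ≤ (-(0 * Λ) - ω + β) * G := by
      simpa only [hβ, hΛ, add_assoc] using hT1
    nlinarith [e]
  have h0' : ν * (∫ x, ⟪laplacian w x, w x⟫) - Pw - ω * Y ≤ -ν * G + (s - ω) * Y := by
    have e : 0 * (∫ x, ⟪laplacian w x, w x⟫) - Pw - ω * Y ≤ (-(0 * Λ) - ω + s) * Y := by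
      simpa only [hΛ] using hT0
    rw [hvisc]
    nlinarith [e]
  -- high-mode Poincaré
  have hab : Λ * G ≤ A := gradNormSq_le_of_truncate_eq_zero hw h0
  have hbe : Λ * Y ≤ G := integral_norm_sq_le_of_truncate_eq_zero hw h0
  have hY0 : 0 ≤ Y := integral_nonneg fun x => sq_nonneg _
  have key := two_level_tail_le (-(ν * A) + P - ω * G)
    (ν * (∫ x, ⟪laplacian w x, w x⟫) - Pw - ω * Y) A G Y Λ κ ν ω β s t₁ τ₂ c hY0 hκ ht₁ hab hbe
    h1 h0' hi hii hiii
  exact key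

/-! ## (C) Threshold arithmetic at the cell's instance (`R = 100`, `K + 1 = 25`, `κ₀ = 10`) -/

/-- `1.41421 < √2 < 1.41422`. -/
private theorem sqrt2_bounds : (1.41421 : ℝ) < Real.sqrt 2 ∧ Real.sqrt 2 < 1.41422 := by
  constructor
  · rw [show (1.41421 : ℝ) = Real.sqrt (1.41421 ^ 2) by rw [Real.sqrt_sq (by norm_num)]]
    exact Real.sqrt_lt_sqrt (by norm_num) (by norm_num)
  · rw [show (1.41422 : ℝ) = Real.sqrt (1.41422 ^ 2) by rw [Real.sqrt_sq (by norm_num)]]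
    exact Real.sqrt_lt_sqrt (by norm_num) (by norm_num)

/-- `1.73205 < √3 < 1.73206`. -/
private theorem sqrt3_bounds : (1.73205 : ℝ) < Real.sqrt 3 ∧ Real.sqrt 3 < 1.73206 := by
  constructor
  · rw [show (1.73205 : ℝ) = Real.sqrt (1.73205 ^ 2) by rw [Real.sqrt_sq (by norm_num)]]
    exact Real.sqrt_lt_sqrt (by norm_num) (by norm_num)
  · rw [show (1.73206 : ℝ) = Real.sqrt (1.73206 ^ 2) by rw [Real.sqrt_sq (by norm_num)]]
    exact Real.sqrt_lt_sqrt (by norm_num) (by norm_num)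

/-- **The ratio `θ = 974/100000` is admissible at `ν = 1/100`, `ω′ = 1/4`, `√Λ = 25`, `κ₀² = 100`
with the generic ABC constants** (`d = 3`, `L = L' = 1`, `s = √2`, so `β = √3 + √2 + √3/25`):
(i′) `θ ≤ 2ν`, (ii′) `θ(Λ + 2κ) ≤ 2(ν(Λ + κ) + ω′ − β)`, (iii′) `θ(Λ + κ)² ≤ 2((Λ + κ)(νΛ + ω′) − βΛ − sκ)`
(desk: the binding (iii′) allows `θ ≤ 0.0097459…`; (ii′) `0.010386…`; (i′) `0.02`). Hence, by
`conditions_of_ratio` and `two_level_tail_le`, the (C1) tail at this booking holds for every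
`t₁ ≥ 0`, `τ₂`, `c` with `c·τ₂ ≤ 0.00974·t₁`. -/
theorem ratio_at_25_quarter :
    (974 / 100000 : ℝ) ≤ 2 * (1 / 100)
    ∧ (974 / 100000 : ℝ) * (25 ^ 2 + 2 * 100)
        ≤ 2 * ((1 / 100) * (25 ^ 2 + 100) + 1 / 4 - (Real.sqrt 3 + Real.sqrt 2 + Real.sqrt 3 / 25))
    ∧ (974 / 100000 : ℝ) * (25 ^ 2 + 100) ^ 2
        ≤ 2 * ((25 ^ 2 + 100) * ((1 / 100) * 25 ^ 2 + 1 / 4)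
              - (Real.sqrt 3 + Real.sqrt 2 + Real.sqrt 3 / 25) * 25 ^ 2 - Real.sqrt 2 * 100) := by
  obtain ⟨a2, b2⟩ := sqrt2_bounds
  obtain ⟨a3, b3⟩ := sqrt3_bounds
  refine ⟨by norm_num, ?_, ?_⟩ <;> nlinarith

/-- **The ratio `θ = 966/100000` is admissible at `ν = 1/100`, `ω′ = 11/50`, `√Λ = 25`, `κ₀² = 100`
with the generic ABC constants** (the `ω′ = 0.22` booking of D2 / cell B; desk: (iii′) allows
`θ ≤ 0.0096632…`, (ii′) `0.010313…`). -/
theorem ratio_at_25_eleven_fiftieths :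
    (966 / 100000 : ℝ) ≤ 2 * (1 / 100)
    ∧ (966 / 100000 : ℝ) * (25 ^ 2 + 2 * 100)
        ≤ 2 * ((1 / 100) * (25 ^ 2 + 100) + 11 / 50 - (Real.sqrt 3 + Real.sqrt 2 + Real.sqrt 3 / 25))
    ∧ (966 / 100000 : ℝ) * (25 ^ 2 + 100) ^ 2
        ≤ 2 * ((25 ^ 2 + 100) * ((1 / 100) * 25 ^ 2 + 11 / 50)
              - (Real.sqrt 3 + Real.sqrt 2 + Real.sqrt 3 / 25) * 25 ^ 2 - Real.sqrt 2 * 100) := by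
  obtain ⟨a2, b2⟩ := sqrt2_bounds
  obtain ⟨a3, b3⟩ := sqrt3_bounds
  refine ⟨by norm_num, ?_, ?_⟩ <;> nlinarith

/-- **The instance, assembled (scalar form).** At `ν = 1/100`, `ω′ = 1/4`, `Λ = 25²`, `κ = 100`,
`β = √3 + √2 + √3/25`, `s = √2`: for all level data `a ≥ Λb`, `b ≥ Λe`, `e ≥ 0` with
`q₁ ≤ −νa + (β − ω′)b`, `q₀ ≤ −νb + (s − ω′)e`, and all `t₁ ≥ 0`, `τ₂`, `c` with
`cτ₂ ≤ (974/100000)·t₁`, the coupled tail form `2t₁(κq₀ + q₁) + cτ₂(a + 2κb + κ²e)` is `≤ 0`. -/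
theorem two_level_tail_le_at_25_quarter (q₁ q₀ a b e t₁ τ₂ c : ℝ) (he : 0 ≤ e) (ht₁ : 0 ≤ t₁)
    (hab : (25 : ℝ) ^ 2 * b ≤ a) (hbe : (25 : ℝ) ^ 2 * e ≤ b)
    (h1 : q₁ ≤ -(1 / 100) * a + ((Real.sqrt 3 + Real.sqrt 2 + Real.sqrt 3 / 25) - 1 / 4) * b)
    (h0 : q₀ ≤ -(1 / 100) * b + (Real.sqrt 2 - 1 / 4) * e)
    (hc : c * τ₂ ≤ 974 / 100000 * t₁) :
    2 * t₁ * (100 * q₀ + q₁) + c * τ₂ * (a + 2 * 100 * b + 100 ^ 2 * e) ≤ 0 := by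
  obtain ⟨r1, r2, r3⟩ := ratio_at_25_quarter
  obtain ⟨c1, c2, c3⟩ := conditions_of_ratio (Λ := (25 : ℝ) ^ 2) (κ := 100) (ν := 1 / 100)
    (ω := 1 / 4) (β := Real.sqrt 3 + Real.sqrt 2 + Real.sqrt 3 / 25) (s := Real.sqrt 2) ht₁
    (by norm_num) hc r1 r2 r3
  exact two_level_tail_le q₁ q₀ a b e ((25 : ℝ) ^ 2) 100 (1 / 100) (1 / 4)
    (Real.sqrt 3 + Real.sqrt 2 + Real.sqrt 3 / 25) (Real.sqrt 2) t₁ τ₂ c he (by norm_num) ht₁ hab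
    hbe h1 h0 c1 c2 c3

end Summit.NavierStokesRegularity.FluidComputer.TwoLevelTailAdmissibility

end
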